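import Summits.Ventures.YMGap.YM4Door.Crossover
import Literature.MathematicalPhysics.QuantumFieldTheory.UnevenAxialBlocking

/-!
# YM4Door / Decimation — WHICH BLOCKING CARRIES N-NP: the axial decimation is admissible and Haar-exact at every depth;
# the Haar point is fixed; iterated decimation and THE ATTRACTOR GLUE; the strong-coupling mirror of N-NP (REQUESTS
# N-DEC «the door decimates into the basin», N-DEC′ «the basin is an attractor») and what they buy at every depth

HONEST FRAMING (cell `ym-beyond`, seat P2 «strong-coupling bridge», HUMAN RULING D-0035 / D-0037; g8 SKETCH, 2026-08-25,
written directly in tree form against the modules `YM4Door/{StripDoor,…,Crossover}` (HOME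
`ROUTE-P2-Lift-*.lean`, `ROUTE-P2-LIFT-SPEC.md`); memo `HOME/ROUTE-P2.md` v0.8 §4g).  LATTICE / finite-torus bookkeeping
only: nothing here is a continuum, spectral or Clay-sense statement; nothing here moves the weak-coupling exit of Track A
(uncertified); nothing here is a part of Bałaban's theorems; NO effective action is asserted to be at any door; N-DEC and
N-DEC′ are TYPED REQUESTS (hypotheses of the closing theorems), NOT facts — for `SU(2)` lattice gauge theory in load
currency they are NOT in print (§4 docstring: what is in print, for finite single-spin spaces).  NO conjecture name, NO
`sorry`, NO axiom beyond the standard three; label K = kernel bookkeeping.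

THE QUESTION (memo §4f → §4g).  `OpenDoor` §3 factorises H-a at scale `g` as N-CVg ∧ N-NP(BK), with N-NP EXISTENTIAL in
the representation of the image under the `K` β-free crossover blockings `BK`.  Which `BK`?  Bałaban's small-field
averaging is defined only on small fields and is not Haar-exact; the tree's AXIAL (straight-line) averaging
`GaugeBlockAveraging.axial b S` (fine link ↦ ordered product of the `b` fine links along the coarse edge from the block
base point — a DECIMATION onto straight transporters) is everywhere defined, gauge-covariant, measurable, and HAAR-EXACT
(tree `UnevenAxialBlocking`: `GaugeBlockAveraging.map_axial_link_torusLinkHaar`, `axial_isBlockingOf_one`).  This file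
draws the consequences and types the strong-coupling mirror of N-NP for THAT blocking.

* §1 HAAR-EXACT BLOCKINGS (`IsHaarExact B :⟺ T_B(dU) = dV`, `isHaarExact_iff_isBlockingOf_one`, `isHaarExact_axial`):
  every fine weight of finite mass IS blocked to its Radon–Nikodym density (`IsHaarExact.isBlockingOf_blockedDensity`,
  `SU2.exists_isBlockingOf_axial` for `e^{−β S_W − 𝒲}`, `|𝒲| ≤ M`) — so N-NP is about LOADS of a representation, never
  about existence of the blocked density; and ★ THE HAAR POINT IS FIXED AT EVERY DEPTH
  (`isBalabanEffectiveActionOf_zero_of_isHaarExact`: fine `β = 0` ↦ `wilsonAt 0` through every Haar-exact `B`, every `ρ`;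
  `SU2.blockClusters_axial_zero`: block-level IR at `β = 0` at every depth, hypothesis-free sanity row).
* §2 GIBBS FORM VIA A LINK MAP (`GibbsFormVia Φ β x`; `= IsBalabanEffectiveActionOf` for `Φ = B.link`; the bare theory is
  its own Gibbs form via `id`, `gibbsFormVia_id_wilsonAt`) and its composition with a crossover image (`GibbsFormVia.comp`).
* §3 ITERATED AXIAL DECIMATION: `iterSize b S K = b^K·S` with `iterSize b S (K+1) = b·iterSize b S K` by `rfl` (no casts),
  `axialIter b S K : GaugeConfig (b^K·S) → GaugeConfig S` (measurable, Haar-exact: `map_axialIter_torusLinkHaar`);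
  `DecimationInvariant b P`; ★ THE ATTRACTOR GLUE `blockIRVia_axialIter`: `P` decimation-invariant ∧ `P ⇒ ClustersWith (A, m)`
  ⇒ a Gibbs form with `P` at ONE depth gives `BlockIRVia (axialIter b S K ∘ Φ)` at EVERY deeper depth, every volume `S ≥ 3`,
  same constants.
* §4 THE REQUESTS, typed: N-DEC(b) `SU2.DoorDecimatesToBasin` (door cell on `b·S'` ↦ axial crossover image AT THE BASIN on
  `S'`, volume-uniformly), N-DEC′(b) `SU2.BasinInvariant` (the basin is decimation-invariant), the large-factor form
  `SU2.DoorFlowsToHaar` (Martinelli–Olivieri shape); what they buy: `blockIRVia_axial_of_door` (one depth),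
  `blockIRVia_axialIter_of_door` (every depth), ★ `blockIRVia_axialIter_bare`: for the BARE strong-coupling theory
  (`β ∈ [0, β₀]`, i.e. `β_W,eff ≤ 2β₀ ≤ 1/3` on the menu) block-level IR after EVERY number `K + 1 ≥ 1` of decimations, on
  every volume — «the strong-coupling expansion takes over» along the whole decimation trajectory (depth `0` = tree door).
* §5 N-NP FOR A BARE CROSSOVER MAP (`IsCrossoverImageVia`, `CrossoverContinuousVia Ψ ref … Q`, `blockIRVia_of_crossoverVia`)
  and the full chain `blockIRVia_decimation_chain`: N-CVg ∧ N-NP(via `Ψ` into the door cell) ∧ N-DEC ∧ N-DEC′ ⇒ block-level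
  IR at every depth beyond scale `g`.

HONEST CAVEATS.  (i) Pure decimation has MARGINAL directions at the trivial fixed point: a term measurable w.r.t. the coarse
(straight-transporter) holonomies is reproduced EXACTLY, a term depending on one interior fine link is washed out — N-DEC is
typed as «door ↦ basin» / «basin ↦ basin» (the clustering regime is preserved), NOT as a contraction of the loads (which is
false for general terms; Yin 2011: the linearised decimation at infinite temperature has dense point spectrum).  (ii) The
decimated Wilson term is paid in LOAD currency by the image `y` (its `y.β` and `y.terms` are existential); at the door edge
`β_W,eff = 1/3` the print-level mechanism (Dobrushin uniqueness of the CONSTRAINED systems, Haller–Kennedy) is NOT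
certified — the constrained single-link rows at `b = 2` carry roughly `(1 + (b+1)/3)×` the door's row mass (rough:
core `β_W,eff ≈ 1/6`); cluster-expansion cores are far deeper (character activities `≈ 0.07`; tree KP corner
`Thresholds/StrongCouplingAnalyticRadius`).  THE NUMBER on this axis (memo §2.8) is therefore «door edge 1/3 (certified
Dobrushin rows) vs decimation core ≈ 1/6 (rough, uncertified)» — a kernel target for the next seat (N-DEC#: the Dobrushin
row of the `b = 2` axially constrained system), not a claim of this file.

NOT HERE: THE NUMBER itself (memo §2); the weak side N-CVg (Track A, `Literature/…/Balaban1983to89/CrossoverLedger`);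
any proof of N-DEC / N-DEC′ / N-NP.

References (what is in print, finite single-spin spaces): R. B. Griffiths, P. A. Pearce, J. Stat. Phys. 20 (1979) 499;
R. B. Israel, in: Random Fields (Esztergom 1979), Vol. II, North-Holland 1981, 593–608; I. A. Kashapov, Theor. Math. Phys.
42 (1980) 184; F. Martinelli, E. Olivieri, J. Stat. Phys. 72 (1993) 1169 [doi:10.1007/bf01048184] and J. Stat. Phys. 79
(1995) 25 [doi:10.1007/bf02179382]; K. Haller, T. Kennedy, J. Stat. Phys. 85 (1996) 607; L. Bertini, E. Cirillo,
E. Olivieri, J. Stat. Phys. 97 (1999) 831 [doi:10.1023/a:1004620929047]; R. Fernández, «Random fields in lattices. The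
Gibbsianness issue» (1998) §5.1, §6.1; A. van Enter, cond-mat/9810405 (1998); M. Yin, J. Math. Phys. 52 (2011)
[doi:10.1063/1.3559129, arXiv:0911.0117]; T. Bałaban, CMP 102 (1985) 255, Introduction (6) [Balaban1985Averaging]; tree
`Literature/MathematicalPhysics/QuantumFieldTheory/{BlockScaleEffectivePerturbation,UnevenAxialBlocking,LatticeGaugeProofs}.lean`,
`Summits/Ventures/YMGap/RobustBall/Defs.lean`.

THIS MODULE: §1–§2; §3–§5 (iterated decimation, the attractor glue, the REQUESTS N-DEC / N-DEC′ and what they buy, N-NP via a bare map) are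
`YM4Door/DecimationFlow.lean` (one text, g8).
-/

noncomputable section

open MeasureTheory Finset Function Metric
open scoped Matrix.Norms.Frobenius
open Literature.Probability.LatticeModels Literature.Probability.LatticeModels.DobrushinMetric
open Literature.MathematicalPhysics.QuantumLattice hiding torusNorm configShift
open Literature.MathematicalPhysics.QuantumFieldTheory hiding ZdEdge
open Summit.Ventures.YMGap.RobustBall
open Summit.Ventures.YMGap.StarResolventDim (Delta gaugeR doorPoly)
open Summit.Ventures.YMGap.YM3IR.ReceiverWitness

namespace Summit.Ventures.YMGap.YM4Door

open scoped ENNReal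

/-! ## §1  HAAR-EXACT BLOCKINGS — every fine weight HAS a blocked density; the Haar point is fixed at every depth

N-NP (`OpenDoor` §3) is EXISTENTIAL in the exit representation.  This section certifies that existence of SOME blocked
density is never the issue for the axial averaging: it is Haar-exact, so every fine weight of finite mass is blocked to its
Radon–Nikodym density (`IsHaarExact.isBlockingOf_blockedDensity`).  What N-NP asks is therefore only about the LOADS of a
polymer representation of `−log σ`, never about `σ`.  And the centre of the Haar basin — fine Yang–Mills at `β = 0`, i.e.
product Haar — is blocked to `wilsonAt 0` at every block factor: the trivial fixed point is an RG image at every depth. -/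

section HaarExact

variable {d : ℕ} {G : Type*} [Group G] [MeasurableSpace G] [TopologicalSpace G] [IsTopologicalGroup G]
  [CompactSpace G] [BorelSpace G] {b S : ℕ} [NeZero b] [NeZero S]

/-- **`B` is HAAR-EXACT**: it pushes the product Haar measure of the fine torus `b·S` to the product Haar measure of the
block torus `S` — Bałaban's normalisation property `∫ (Tρ)(V) dV = ∫ ρ(U) dU` for all `ρ` at once (CMP 102 (1985)
Introduction (6)), equivalently `T_B(dU) = dV` (`isHaarExact_iff_isBlockingOf_one`). -/
@[folklore] def IsHaarExact (B : GaugeBlockAveraging d G b S) : Prop :=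
  (torusLinkHaar d G (b * S)).map B.link = torusLinkHaar d G S

/-- Haar-exactness is `T_B(dU) = dV`, i.e. `IsBlockingOf 1 1`. -/
theorem isHaarExact_iff_isBlockingOf_one (B : GaugeBlockAveraging d G b S) : IsHaarExact B ↔ B.IsBlockingOf 1 1 := by
  rw [GaugeBlockAveraging.IsBlockingOf, GaugeBlockAveraging.blockedWeight, withDensity_one, withDensity_one]
  exact Iff.rfl

/-- **The axial (straight-line) averaging is Haar-exact at every block factor** (tree `UnevenAxialBlocking`: the image
of product Haar is a translation-invariant probability measure, hence product Haar — Bałaban CMP 102 (1985) (6)). -/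
theorem isHaarExact_axial [SecondCountableTopology G] :
    IsHaarExact (GaugeBlockAveraging.axial (d := d) (G := G) b S) :=
  GaugeBlockAveraging.map_axial_link_torusLinkHaar

/-- A Haar-exact blocking sends EVERY fine weight to a measure absolutely continuous w.r.t. block product Haar. -/
theorem IsHaarExact.absolutelyContinuous {B : GaugeBlockAveraging d G b S} (h : IsHaarExact B)
    (w : GaugeConfig d (b * S) G → ℝ≥0∞) : B.blockedWeight w ≪ torusLinkHaar d G S := by
  rw [GaugeBlockAveraging.blockedWeight, ← h]
  exact (withDensity_absolutelyContinuous _ w).map B.measurable_link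

/-- **The canonical blocked density** `σ_B(w) := d T_B(w dU) / dV` (Radon–Nikodym derivative w.r.t. block product Haar). -/
def blockedDensity (B : GaugeBlockAveraging d G b S) (w : GaugeConfig d (b * S) G → ℝ≥0∞) : GaugeConfig d S G → ℝ≥0∞ :=
  (B.blockedWeight w).rnDeriv (torusLinkHaar d G S)

/-- The canonical blocked density is measurable. -/
theorem measurable_blockedDensity (B : GaugeBlockAveraging d G b S) (w : GaugeConfig d (b * S) G → ℝ≥0∞) :
    Measurable (blockedDensity B w) :=
  Measure.measurable_rnDeriv _ _

/-- ★ **For a Haar-exact blocking every fine weight of finite mass IS blocked to its canonical density**: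
`T_B(w dU) = σ_B(w) dV` (`GaugeBlockAveraging.IsBlockingOf`). -/
theorem IsHaarExact.isBlockingOf_blockedDensity {B : GaugeBlockAveraging d G b S} (h : IsHaarExact B)
    {w : GaugeConfig d (b * S) G → ℝ≥0∞} (hw : ∫⁻ U, w U ∂torusLinkHaar d G (b * S) ≠ ∞) :
    B.IsBlockingOf w (blockedDensity B w) := by
  haveI : IsFiniteMeasure (B.blockedWeight w) :=
    ⟨by rw [GaugeBlockAveraging.blockedWeight_univ]; exact hw.lt_top⟩
  exact (Measure.withDensity_rnDeriv_eq _ _ (h.absolutelyContinuous w)).symm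

/-- For a Haar-exact blocking every fine weight of finite mass has SOME measurable blocked density. -/
theorem IsHaarExact.exists_isBlockingOf {B : GaugeBlockAveraging d G b S} (h : IsHaarExact B)
    {w : GaugeConfig d (b * S) G → ℝ≥0∞} (hw : ∫⁻ U, w U ∂torusLinkHaar d G (b * S) ≠ ∞) :
    ∃ σ : GaugeConfig d S G → ℝ≥0∞, Measurable σ ∧ B.IsBlockingOf w σ :=
  ⟨blockedDensity B w, measurable_blockedDensity B w, h.isBlockingOf_blockedDensity hw⟩

/-- A weight `e^{f}` with `f ≤ M` pointwise has finite mass against product Haar (a probability measure). -/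
theorem lintegral_ofReal_exp_ne_top {L : ℕ} [NeZero L] {f : GaugeConfig d L G → ℝ} {M : ℝ} (hf : ∀ U, f U ≤ M) :
    ∫⁻ U, ENNReal.ofReal (Real.exp (f U)) ∂torusLinkHaar d G L ≠ ∞ := by
  have hb : ∫⁻ U, ENNReal.ofReal (Real.exp (f U)) ∂torusLinkHaar d G L
      ≤ ENNReal.ofReal (Real.exp M) * torusLinkHaar d G L Set.univ :=
    calc ∫⁻ U, ENNReal.ofReal (Real.exp (f U)) ∂torusLinkHaar d G L
        ≤ ∫⁻ _U, ENNReal.ofReal (Real.exp M) ∂torusLinkHaar d G L :=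
          lintegral_mono fun U => ENNReal.ofReal_le_ofReal (Real.exp_le_exp.2 (hf U))
      _ = ENNReal.ofReal (Real.exp M) * torusLinkHaar d G L Set.univ := lintegral_const _
  exact ne_top_of_le_ne_top (ENNReal.mul_ne_top ENNReal.ofReal_ne_top (measure_ne_top (torusLinkHaar d G L) Set.univ)) hb

/-- **Yang–Mills tilted by a BOUNDED functional has finite mass** (tree `exists_abs_wilsonAction_le`): the finite-mass
hypothesis of `IsHaarExact.isBlockingOf_blockedDensity` holds for every `e^{−β S_W − 𝒲}`, `|𝒲| ≤ M` — in particular for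
the Gibbs weight `e^{−x}` of every Bałaban-format action `x` with bounded terms. -/
theorem lintegral_perturbedWilsonDensity_ne_top {N L : ℕ} [NeZero L] (ρ : G →* Matrix (Fin N) (Fin N) ℂ)
    (hρ : Continuous ρ) (β : ℝ) {𝒲 : GaugeConfig d L G → ℝ} {M : ℝ} (h𝒲 : ∀ U, |𝒲 U| ≤ M) :
    ∫⁻ U, perturbedWilsonDensity ρ β 𝒲 U ∂torusLinkHaar d G L ≠ ∞ := by
  obtain ⟨A, hA⟩ := exists_abs_wilsonAction_le (d := d) (L := L) ρ hρ
  show ∫⁻ U, ENNReal.ofReal (Real.exp (-β * wilsonAction ρ U - 𝒲 U)) ∂torusLinkHaar d G L ≠ ∞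
  refine lintegral_ofReal_exp_ne_top (f := fun U => -β * wilsonAction ρ U - 𝒲 U) (M := |β| * A + M) fun U => ?_
  have h1 : -β * wilsonAction ρ U ≤ |β| * A := by
    calc -β * wilsonAction ρ U ≤ |(-β) * wilsonAction ρ U| := le_abs_self _
      _ = |β| * |wilsonAction ρ U| := by rw [abs_mul, abs_neg]
      _ ≤ |β| * A := mul_le_mul_of_nonneg_left (hA U) (abs_nonneg β)
  have h2 : -𝒲 U ≤ M := (neg_le_abs _).trans (h𝒲 U)
  show -β * wilsonAction ρ U - 𝒲 U ≤ |β| * A + M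
  linarith

/-- ★ **THE HAAR POINT IS A FIXED POINT OF EVERY HAAR-EXACT BLOCKING.**  Blocking fine Yang–Mills at `β = 0` (product
Haar) through a Haar-exact `B` gives the effective action `wilsonAt 0` — no coupling, no terms: the centre of the Haar
basin (`HaarForm` §3, §5) is a renormalisation-group image AT EVERY DEPTH, for every representation `ρ`. -/
theorem isBalabanEffectiveActionOf_zero_of_isHaarExact {N c : ℕ} (ρ : G →* Matrix (Fin N) (Fin N) ℂ)
    {B : GaugeBlockAveraging d G b S} (h : IsHaarExact B) :
    IsBalabanEffectiveActionOf ρ B 0 (BalabanEffectiveAction.wilsonAt (c := c) 0) := by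
  have h1 : perturbedWilsonDensity ρ 0 (0 : GaugeConfig d (b * S) G → ℝ) = 1 := by
    funext U; simp [perturbedWilsonDensity]
  have h2 : (BalabanEffectiveAction.wilsonAt (d := d) (S := S) (G := G) (c := c) 0).density ρ = 1 := by
    funext V; simp [BalabanEffectiveAction.density]
  unfold IsBalabanEffectiveActionOf
  rw [h1, h2]
  exact (isHaarExact_iff_isBlockingOf_one B).1 h

end HaarExact

namespace SU2

variable {b S : ℕ} [NeZero b] [NeZero S]

/-- The axial averaging of `SU(2)` fields in `d = 4` is Haar-exact (instance of `isHaarExact_axial`). -/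
theorem isHaarExact_axial_su2 : IsHaarExact (GaugeBlockAveraging.axial (d := 4) (G := SUN 2) b S) :=
  isHaarExact_axial

/-- ★ **EVERY fine `SU(2)` Yang–Mills weight tilted by a bounded functional HAS an axially blocked density**, at every
block factor `b` and every volume: the existential half of N-NP is free for the axial averaging. -/
theorem exists_isBlockingOf_axial (β : ℝ) {𝒲 : GaugeConfig 4 (b * S) (SUN 2) → ℝ} {M : ℝ} (h𝒲 : ∀ U, |𝒲 U| ≤ M) :
    ∃ σ : GaugeConfig 4 S (SUN 2) → ℝ≥0∞, Measurable σ ∧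
      (GaugeBlockAveraging.axial b S).IsBlockingOf (perturbedWilsonDensity ρ2 β 𝒲) σ :=
  isHaarExact_axial_su2.exists_isBlockingOf (lintegral_perturbedWilsonDensity_ne_top ρ2 continuous_ρ2 β h𝒲)

/-- **At `β = 0` the axially blocked action is `wilsonAt 0` at every depth.** -/
theorem isBalabanEffectiveActionOf_axial_zero :
    IsBalabanEffectiveActionOf ρ2 (GaugeBlockAveraging.axial (d := 4) b S) 0 (BalabanEffectiveAction.wilsonAt (c := 1) 0) :=
  isBalabanEffectiveActionOf_zero_of_isHaarExact ρ2 isHaarExact_axial_su2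

/-- `wilsonAt 0` is at the Haar door (any rate `κ ≥ 1/100`, oscillation radius `0`). -/
theorem atHaarDoor_wilsonAt_zero {κ : ℝ} (hκ : 1 / 100 ≤ κ) :
    AtHaarDoor (BalabanEffectiveAction.wilsonAt (d := 4) (S := S) (G := SUN 2) (c := 1) 0) κ 0 :=
  ⟨rfl, hκ, le_rfl, zero_mem_clusterDomain le_rfl (by norm_num)⟩

/-- **Sanity row — block-level IR at `β = 0` at EVERY decimation depth**, hypothesis-free: the Haar point is fixed
(`isBalabanEffectiveActionOf_axial_zero`) and sits at the Haar door (`HaarForm` §3). -/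
theorem blockClusters_axial_zero (hS : 3 ≤ S) :
    BlockClusters (GaugeBlockAveraging.axial b S) 0 (16 * Real.exp (1 / 50)) (1 / 100) :=
  blockClusters_of_atHaarDoor hS isBalabanEffectiveActionOf_axial_zero (atHaarDoor_wilsonAt_zero le_rfl)

end SU2

/-! ## §2  GIBBS FORM VIA A LINK MAP, and its composition with a crossover image

`OpenDoor` §3 composes a Gibbs form under a blocking `Bg` with ONE crossover image (`blockIRVia_comp`).  Iterated
decimation needs the same for an arbitrary measurable link map `Φ` (a composite of several averagings is not itself a
`GaugeBlockAveraging` of the tree: the fine side `b₁·(b₂·S)` is not syntactically `(b₁b₂)·S`).  `GibbsFormVia Φ β x` is the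
first clause of `BlockIRVia Φ`; for `Φ = B.link` it IS `IsBalabanEffectiveActionOf` (`gibbsFormVia_link_iff`). -/

section Via

variable {n S : ℕ} [NeZero n] [NeZero S]

/-- **`x` is the GIBBS FORM of fine `SU(2)` Yang–Mills at `β` under the link map `Φ`** (fine torus `n` → block torus `S`):
the fine Wilson law pushed along `Φ` is `e^{−x(V)} dV`. -/
@[folklore] def GibbsFormVia (Φ : GaugeConfig 4 n (SUN 2) → GaugeConfig 4 S (SUN 2)) (β : ℝ)
    (x : BalabanEffectiveAction 4 S (SUN 2) 1) : Prop :=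
  ((torusLinkHaar 4 (SUN 2) n).withDensity (perturbedWilsonDensity SU2.ρ2 β 0)).map Φ =
    (torusLinkHaar 4 (SUN 2) S).withDensity (x.density SU2.ρ2)

/-- For a tree blocking, Gibbs form via `B.link` IS `IsBalabanEffectiveActionOf` (definitional). -/
theorem gibbsFormVia_link_iff {b : ℕ} [NeZero b] (B : GaugeBlockAveraging 4 (SUN 2) b S) (β : ℝ)
    (x : BalabanEffectiveAction 4 S (SUN 2) 1) : GibbsFormVia B.link β x ↔ IsBalabanEffectiveActionOf SU2.ρ2 B β x :=
  Iff.rfl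

/-- Gibbs form via `Φ` ∧ the form clusters ⇒ `BlockIRVia Φ`. -/
theorem GibbsFormVia.blockIRVia {Φ : GaugeConfig 4 n (SUN 2) → GaugeConfig 4 S (SUN 2)} {β A m : ℝ}
    {x : BalabanEffectiveAction 4 S (SUN 2) 1} (hx : GibbsFormVia Φ β x) (hcl : ClustersWith x.terms x.β A m) :
    BlockIRVia Φ β A m :=
  ⟨x, hx, hcl⟩

/-- **The bare theory is its own Gibbs form via the identity**: `e^{−β S_W} dU` is the Gibbs law of `wilsonAt β`. -/
theorem gibbsFormVia_id_wilsonAt (β : ℝ) :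
    GibbsFormVia (id : GaugeConfig 4 S (SUN 2) → GaugeConfig 4 S (SUN 2)) β (BalabanEffectiveAction.wilsonAt β) := by
  unfold GibbsFormVia
  rw [Measure.map_id]
  congr 1
  funext U
  simp [BalabanEffectiveAction.density, perturbedWilsonDensity, neg_mul]

/-- ★ **Gibbs forms compose through crossover images along bare link maps**: `x` the Gibbs form via `Φ` (to the torus
`bK·S`) and `y` a crossover image of `x` under `BK` ⇒ `y` is the Gibbs form via `BK.link ∘ Φ` (`Measure.map_map`). -/
theorem GibbsFormVia.comp {bK : ℕ} [NeZero bK] {Φ : GaugeConfig 4 n (SUN 2) → GaugeConfig 4 (bK * S) (SUN 2)}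
    (hΦ : Measurable Φ) (BK : GaugeBlockAveraging 4 (SUN 2) bK S) {β : ℝ}
    {x : BalabanEffectiveAction 4 (bK * S) (SUN 2) 1} {y : BalabanEffectiveAction 4 S (SUN 2) 1}
    (hx : GibbsFormVia Φ β x) (hy : IsCrossoverImage BK x y) : GibbsFormVia (BK.link ∘ Φ) β y := by
  unfold GibbsFormVia
  rw [← Measure.map_map BK.measurable_link hΦ, hx]
  exact hy

end Via

end Summit.Ventures.YMGap.YM4Door

end
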